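import Summits.QuantumFields.YangMills.Theorems.ColdBoxAllGroupsBulkAllGroupsCrudeGoodLargeFieldFlatG

/-!
# Conditioning the box kernel with a crude-good datum on the small-field event at the FLAT rate `ε > 2θ + δ` (any compact gauge group) —
# flat-rate twins of `ColdBoxAllGroups.abs_boxKernelG_integral_sub_cond_le` / `abs_boxKernelG_cov_sub_cond_le`

With the flat-rate kernel rarity `boxKernelG_real_coldGoodSetG_compl_le_flat` (`…CrudeGoodLargeFieldFlatG`, obligation R of LINE-18 v5 on crux
`BulkMidWindowSU2`, stmt-QuantumFields-24006) in place of B5-G, the two restriction steps of the one-scale expansions with datum hold for every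
`ε > 2θ + δ` (instead of `3θ + δ`): conditioning on `coldGoodSetG ρ H β ε` moves bounded kernel means by `≤ 2M_f e^{−β^ε}` and bounded connected
two-point functions by `≤ 6M_fM_g e^{−β^ε}`, uniformly over crude-good data — the form in which LINE-18's S6/S7 (`stub_kernelMeanExpansionMidG`,
`stub_kernelCovExpansionMidG`) restrict to the small-field event at `ε` just above `2θ + δ` (memo l21 §3).  Proofs verbatim from the `3θ + δ` file.
No sorry, no definition, standard axioms.  HONEST LABEL: helper; no stub/crux/rung/summit; the Yang–Mills mass gap is NOT proved by any of this.
-/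

set_option autoImplicit false

noncomputable section

open MeasureTheory ProbabilityTheory Finset Real
open Literature.Probability.LatticeModels
open Literature.MathematicalPhysics.QuantumLattice
open Literature.MathematicalPhysics.QuantumFieldTheory
open Literature.MathematicalPhysics.QuantumFieldTheory.AxialGauge
open Summit.QuantumFields.YangMills.Theorems.WeakCouplingRates

namespace Summit.QuantumFields.YangMills.Theorems.ColdBoxAllGroups

variable {N : ℕ} [NeZero N] {G : Type*} [Group G] [TopologicalSpace G] [IsTopologicalGroup G] [CompactSpace G]
  [MeasurableSpace G] [BorelSpace G] [SecondCountableTopology G]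
variable (ρ : G →* Matrix (Fin N) (Fin N) ℂ) (hρu : ∀ g, ρ g ∈ Matrix.unitaryGroup (Fin N) ℂ) (hρc : Continuous ρ)

include hρu hρc in
/-- **H-T6 for MEANS (the `KernelMeanExpansion` restriction step)**: for `0 < θ`, `0 ≤ δ`, `2θ + δ < ε` (FLAT rate), eventually in `β`, for every crude-good datum
`ω` and every bounded measurable observable `f` (`|f| ≤ M_f`),
`|E_{γ(·|ω)}[f] − E_{γ(·|ω)}[f | coldGoodSet]| ≤ 2M_f·e^{−β^ε}`. -/
theorem abs_boxKernelG_integral_sub_cond_le_flat {θ δ ε : ℝ} (hθ : 0 < θ) (hδ : 0 ≤ δ) (hε : 2 * θ + δ < ε) :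
    ∃ β₀ : ℝ, ∀ β : ℝ, β₀ ≤ β → ∀ ω : LGConfig 4 G, CrudeGoodG ρ β δ ⌈β ^ θ⌉₊ ω →
      ∀ (f : LGConfig 4 G → ℝ) (Mf : ℝ), Measurable f → (∀ U, |f U| ≤ Mf) →
        |(∫ U, f U ∂(boxKernelG ρ β ⌈β ^ θ⌉₊ ω)) - ∫ U, f U ∂((boxKernelG ρ β ⌈β ^ θ⌉₊ ω)[|coldGoodSetG ρ ⌈β ^ θ⌉₊ β ε])| ≤
          2 * Mf * Real.exp (-(β ^ ε)) := by
  obtain ⟨β₀, hβ₀⟩ := boxKernelG_real_coldGoodSetG_compl_le_flat ρ hρu hρc hθ hδ hε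
  refine ⟨max β₀ 1, fun β hβ ω hω f Mf hfm hM => ?_⟩
  have hb0 : β₀ ≤ β := (le_max_left _ _).trans hβ
  have hβ1 : (1 : ℝ) ≤ β := (le_max_right _ _).trans hβ
  set μ := boxKernelG ρ β ⌈β ^ θ⌉₊ ω with hμ
  haveI : IsProbabilityMeasure μ := isProbabilityMeasure_boxKernelG ρ hρc β _ ω
  have hbad : μ.real (coldGoodSetG ρ ⌈β ^ θ⌉₊ β ε)ᶜ ≤ Real.exp (-(β ^ ε)) := hβ₀ β hb0 ω hω
  have hG0 : μ (coldGoodSetG ρ ⌈β ^ θ⌉₊ β ε) ≠ 0 := boxKernelG_coldGoodSetG_ne_zero ρ hρc (by linarith) hbad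
  have hMf0 : 0 ≤ Mf := (abs_nonneg _).trans (hM fun _ => 1)
  have hfi : Integrable f μ := integrable_of_bound hfm.aestronglyMeasurable hM
  have key := abs_integral_sub_integral_cond_le (μ := μ) (measurableSet_coldGoodSetG ρ hρc β ε) hG0 hfi hM
  calc _ ≤ 2 * Mf * μ.real (coldGoodSetG ρ ⌈β ^ θ⌉₊ β ε)ᶜ := key
    _ ≤ 2 * Mf * Real.exp (-(β ^ ε)) := mul_le_mul_of_nonneg_left hbad (by positivity)

include hρu hρc in
/-- **H-T6 for COVARIANCES (the `KernelCovExpansion` restriction step)**: for `0 < θ`, `0 ≤ δ`, `2θ + δ < ε` (FLAT rate), eventually in `β`, for every crude-good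
datum `ω` and bounded measurable `f, g` (`|f| ≤ M_f`, `|g| ≤ M_g`),
`|Cov_{γ(·|ω)}(f,g) − Cov_{γ(·|ω)[|coldGoodSet]}(f,g)| ≤ 6M_fM_g·e^{−β^ε}`. -/
theorem abs_boxKernelG_cov_sub_cond_le_flat {θ δ ε : ℝ} (hθ : 0 < θ) (hδ : 0 ≤ δ) (hε : 2 * θ + δ < ε) :
    ∃ β₀ : ℝ, ∀ β : ℝ, β₀ ≤ β → ∀ ω : LGConfig 4 G, CrudeGoodG ρ β δ ⌈β ^ θ⌉₊ ω →
      ∀ (f g : LGConfig 4 G → ℝ) (Mf Mg : ℝ), Measurable f → Measurable g →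
        (∀ U, |f U| ≤ Mf) → (∀ U, |g U| ≤ Mg) →
        |((∫ U, f U * g U ∂(boxKernelG ρ β ⌈β ^ θ⌉₊ ω)) -
              (∫ U, f U ∂(boxKernelG ρ β ⌈β ^ θ⌉₊ ω)) * (∫ U, g U ∂(boxKernelG ρ β ⌈β ^ θ⌉₊ ω))) -
            ((∫ U, f U * g U ∂((boxKernelG ρ β ⌈β ^ θ⌉₊ ω)[|coldGoodSetG ρ ⌈β ^ θ⌉₊ β ε])) -
              (∫ U, f U ∂((boxKernelG ρ β ⌈β ^ θ⌉₊ ω)[|coldGoodSetG ρ ⌈β ^ θ⌉₊ β ε])) *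
                (∫ U, g U ∂((boxKernelG ρ β ⌈β ^ θ⌉₊ ω)[|coldGoodSetG ρ ⌈β ^ θ⌉₊ β ε])))| ≤
          6 * Mf * Mg * Real.exp (-(β ^ ε)) := by
  obtain ⟨β₀, hβ₀⟩ := boxKernelG_real_coldGoodSetG_compl_le_flat ρ hρu hρc hθ hδ hε
  refine ⟨max β₀ 1, fun β hβ ω hω f g Mf Mg hfm hgm hMf hMg => ?_⟩
  have hb0 : β₀ ≤ β := (le_max_left _ _).trans hβ
  have hβ1 : (1 : ℝ) ≤ β := (le_max_right _ _).trans hβ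
  set μ := boxKernelG ρ β ⌈β ^ θ⌉₊ ω with hμ
  haveI : IsProbabilityMeasure μ := isProbabilityMeasure_boxKernelG ρ hρc β _ ω
  have hbad : μ.real (coldGoodSetG ρ ⌈β ^ θ⌉₊ β ε)ᶜ ≤ Real.exp (-(β ^ ε)) := hβ₀ β hb0 ω hω
  have hG0 : μ (coldGoodSetG ρ ⌈β ^ θ⌉₊ β ε) ≠ 0 := boxKernelG_coldGoodSetG_ne_zero ρ hρc (by linarith) hbad
  have hMf0 : 0 ≤ Mf := (abs_nonneg _).trans (hMf fun _ => 1)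
  have hMg0 : 0 ≤ Mg := (abs_nonneg _).trans (hMg fun _ => 1)
  have hfi : Integrable f μ := integrable_of_bound hfm.aestronglyMeasurable hMf
  have hgi : Integrable g μ := integrable_of_bound hgm.aestronglyMeasurable hMg
  have hfgi : Integrable (fun U => f U * g U) μ := integrable_of_bound (hfm.mul hgm).aestronglyMeasurable (C := Mf * Mg)
    (fun U => by rw [abs_mul]; exact mul_le_mul (hMf U) (hMg U) (abs_nonneg _) hMf0)
  have key := abs_cov_sub_cov_cond_le (μ := μ) (measurableSet_coldGoodSetG ρ hρc β ε) hG0 hfi hgi hfgi hMf hMg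
  calc _ ≤ 6 * Mf * Mg * μ.real (coldGoodSetG ρ ⌈β ^ θ⌉₊ β ε)ᶜ := key
    _ ≤ 6 * Mf * Mg * Real.exp (-(β ^ ε)) := mul_le_mul_of_nonneg_left hbad (by positivity)

end Summit.QuantumFields.YangMills.Theorems.ColdBoxAllGroups

end
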